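import Summits.QuantumFields.QCD.Theses.HeatSlicedQuarks
import Summits.QuantumFields.QCD.Theorems.HeatSlicedQuarksQuarkLoopCoefficientSecondOrderCoefficientAuxD
import Summits.QuantumFields.QCD.Theorems.HeatSlicedQuarksQuarkLoopCoefficientSecondOrderCoefficientAuxF

/-!
# Quark-loop coefficient (crux stmt-QuantumFields-16786, line `Sketch`): stub `stub_secondOrderCoefficient`

The spin-traced second-order coefficient `e2 t` of the symmetric-gauge heat symbol at the origin (the
`θ²`-coefficient per unit charge of the on-diagonal massless Wilson heat kernel in constant flux; Defs file)
tends to `1/(12π²)` at the log-free rate `C/t`: `FreeMajorantToolkit → FreeHeatCalculus → SecondOrderCoefficient`.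
Proof (parts A–F in `…SecondOrderCoefficientAux*.lean`, assembled here).  SINGLE-MOMENTUM COLLAPSE: by the
scalar free `D♯D` symbol the first Moyal defect vanishes, `vtx 1 (k_r·1) = η ∗ k_r`, `E₁(s) = −s η ∗ k_s`; the
`w`-sums of the second-order integrand against `k_{t−s}(w)` collapse by the semigroup law and the IBP identity
`t(z_νĥ) ∗ k_t + w_νk_t = 0` to finite combinations of `k_t`, polynomial in `s`, whence
`e2 t = −(tA₀ + (t²/6)(A₁ₐ + A₁ᵦ) + (t²/2)A₂)` (part D).  This file: the `k_t(0)`-coefficients of `A₁ₐ, A₁ᵦ, A₂`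
are `4, 0, −4` (Clifford/moment computations `Σ tr[ηη] = 4`, `Σ v_μv_νĥ = −2δ`, `Σ v_μ ĥ = 0`), combining to
`(4/3)t²k_t(0) → (4/3)/(16π²) = 1/(12π²)`; the remainders are `O(1/t)` by the LAPLACE ASYMPTOTICS of part F
(`|k_t(u) − k_t(0)| ≤ C|u|²/t³`, `|k_t(0) − 1/(16π²t²)| ≤ C/t³`) and `|k_t(u)| ≤ C/t²` (the toolkit's Gaussian
majorant); `final_bound` is the bookkeeping and the last theorem is the registered stub.
-/

noncomputable section

namespace Summit.QuantumFields.QCD.Cruxes.QuarkLoopCoefficient.Sketch.SecondOrderCoefficient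

open Literature.MathematicalPhysics.QuantumLattice Literature.MathematicalPhysics.QuantumFieldTheory
open Literature.Probability.LatticeModels (Site TorusSite)
open Summit.QuantumFields.QCD.Theorems.QuarkLoopCoefficient
open Summit.QuantumFields.QCD.Cruxes.QuarkLoopCoefficient.Sketch.HeatSeries
open scoped Matrix ComplexConjugate

attribute [local irreducible] nbr nbr2

section Constants

variable (hsq : ∀ x y : Site 4, sqKer (fun _ => (1 : ℂ)) x y = ((hhat (y - x) : ℝ) : ℂ) • (1 : Spin))
include hsq

/-- `Σ_{z ∈ nbr 0} tr[ď♯(z) ď(v − z)] = 4 ĥ(v)`. -/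
theorem sum_trace_dsharp_mul_dsymb (v : Site 4) :
    ∑ z ∈ nbr 0, (dsharp z * dsymb (v - z)).trace = 4 * ((hhat v : ℝ) : ℂ) := by
  rw [← Matrix.trace_sum, sum_dsharp_mul_dsymb hsq v, Matrix.trace_smul, Matrix.trace_one, Fintype.card_fin,
    smul_eq_mul]
  push_cast
  ring

/-- `Σ_{z'} ĥ(z') (v∧z')² = −2 (v₀² + v₁²)` (second moments of `ĥ`). -/
theorem sum_hhat_mul_wedge_sq (v : Site 4) :
    ∑ z' ∈ nbr2 0, hhat z' * ((wedge v z' : ℤ) : ℝ) ^ 2 = -2 * (((v 0 : ℤ) : ℝ) ^ 2 + ((v 1 : ℤ) : ℝ) ^ 2) := by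
  have e : ∀ z' : Site 4, hhat z' * ((wedge v z' : ℤ) : ℝ) ^ 2 =
      ((v 0 : ℤ) : ℝ) ^ 2 * (((z' 1 : ℤ) : ℝ) * ((z' 1 : ℤ) : ℝ) * hhat z') +
        ((v 1 : ℤ) : ℝ) ^ 2 * (((z' 0 : ℤ) : ℝ) * ((z' 0 : ℤ) : ℝ) * hhat z') -
        2 * ((v 0 : ℤ) : ℝ) * ((v 1 : ℤ) : ℝ) * (((z' 0 : ℤ) : ℝ) * ((z' 1 : ℤ) : ℝ) * hhat z') := by
    intro z'; simp only [wedge]; push_cast; ring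
  rw [Finset.sum_congr rfl fun z' _ => e z', Finset.sum_sub_distrib, Finset.sum_add_distrib, ← Finset.mul_sum,
    ← Finset.mul_sum, ← Finset.mul_sum, sum_coord_mul_coord_mul_hhat hsq 1 1, sum_coord_mul_coord_mul_hhat hsq 0 0,
    sum_coord_mul_coord_mul_hhat hsq 0 1]
  simp
  ring

/-- The constant of `A₁`: `Σ_{v,z} (tr[ď♯(z)ď(v−z)]/8) Σ_{z'} ĥ(z')(v∧z')² = 4`. -/
theorem constant_A1a :
    ∑ v ∈ nbr2 0, ∑ z ∈ nbr 0, ((dsharp z * dsymb (v - z)).trace / 8) *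
      (((∑ z' ∈ nbr2 0, hhat z' * ((wedge v z' : ℤ) : ℝ) ^ 2) : ℝ) : ℂ) = 4 := by
  have h1 : ∀ v ∈ nbr2 0, ∑ z ∈ nbr 0, ((dsharp z * dsymb (v - z)).trace / 8) *
      (((∑ z' ∈ nbr2 0, hhat z' * ((wedge v z' : ℤ) : ℝ) ^ 2) : ℝ) : ℂ) =
      (((((v 0 : ℤ) : ℝ) * ((v 0 : ℤ) : ℝ) * hhat v + ((v 1 : ℤ) : ℝ) * ((v 1 : ℤ) : ℝ) * hhat v) : ℝ) : ℂ) *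
        (-1) := by
    intro v _
    rw [← Finset.sum_mul, ← Finset.sum_div, sum_trace_dsharp_mul_dsymb hsq v, sum_hhat_mul_wedge_sq hsq v]
    push_cast
    ring
  rw [Finset.sum_congr rfl h1, ← Finset.sum_mul, ← Complex.ofReal_sum, Finset.sum_add_distrib,
    sum_coord_mul_coord_mul_hhat hsq 0 0, sum_coord_mul_coord_mul_hhat hsq 1 1]
  simp
  norm_num

/-- The constant of the mixed term vanishes: `Σ_{v,v'} ĥ(v) tr η(v') · v∧(v+v') = 0` (first moments of `ĥ`). -/
theorem constant_A1b :
    ∑ v ∈ nbr2 0, ∑ v' ∈ nbr2 0, (-(Complex.I / 2 * ((hhat v : ℝ) : ℂ) *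
        (∑ z ∈ nbr 0, (Complex.I / 2 * ((wedge z v' : ℤ) : ℂ)) • (dsharp z * dsymb (v' - z))).trace)) *
      (((wedge v (v + v') : ℤ) : ℝ) : ℂ) = 0 := by
  rw [Finset.sum_comm]
  refine Finset.sum_eq_zero fun v' _ => ?_
  have h0 := sum_coord_mul_hhat hsq 0
  have h1 := sum_coord_mul_hhat hsq 1
  have hW : ∑ v ∈ nbr2 0, hhat v * ((wedge v (v + v') : ℤ) : ℝ) = 0 := by
    have e : ∀ v : Site 4, hhat v * ((wedge v (v + v') : ℤ) : ℝ) =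
        ((v' 1 : ℤ) : ℝ) * (((v 0 : ℤ) : ℝ) * hhat v) - ((v' 0 : ℤ) : ℝ) * (((v 1 : ℤ) : ℝ) * hhat v) := by
      intro v; rw [add_comm, wedge_add_self_right]; simp only [wedge]; push_cast; ring
    rw [Finset.sum_congr rfl fun v _ => e v, Finset.sum_sub_distrib, ← Finset.mul_sum, ← Finset.mul_sum, h0, h1]
    ring
  have e2 : ∀ v : Site 4, (-(Complex.I / 2 * ((hhat v : ℝ) : ℂ) *
      (∑ z ∈ nbr 0, (Complex.I / 2 * ((wedge z v' : ℤ) : ℂ)) • (dsharp z * dsymb (v' - z))).trace)) *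
      (((wedge v (v + v') : ℤ) : ℝ) : ℂ) =
      (-(Complex.I / 2) * (∑ z ∈ nbr 0, (Complex.I / 2 * ((wedge z v' : ℤ) : ℂ)) • (dsharp z * dsymb (v' - z))).trace) *
        (((hhat v * ((wedge v (v + v') : ℤ) : ℝ)) : ℝ) : ℂ) := by
    intro v; push_cast; ring
  rw [Finset.sum_congr rfl fun v _ => e2 v, ← Finset.mul_sum, ← Complex.ofReal_sum, hW]
  simp

omit hsq in
/-- The constant of `A₂`: `Σ_{v,v'} (−tr[η(v)η(v')]) = −4`. -/
theorem constant_A2 :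
    ∑ v ∈ nbr2 0, ∑ v' ∈ nbr2 0,
      -((∑ z ∈ nbr 0, (Complex.I / 2 * ((wedge z v : ℤ) : ℂ)) • (dsharp z * dsymb (v - z))) *
        (∑ z ∈ nbr 0, (Complex.I / 2 * ((wedge z v' : ℤ) : ℂ)) • (dsharp z * dsymb (v' - z)))).trace = -4 := by
  simp only [Finset.sum_neg_distrib]
  rw [sum_sum_trace_vertexOne_mul]

/-- `A₁ₐ = 4 k_t(0) + R₁ₐ`. -/
theorem A1a_eq (t : ℝ) :
    ∑ v ∈ nbr2 0, ∑ z ∈ nbr 0, ((dsharp z * dsymb (v - z)).trace / 8) *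
        (((∑ z' ∈ nbr2 0, hhat z' * ((wedge v z' : ℤ) : ℝ) ^ 2 * freeKer t (v + z')) : ℝ) : ℂ) =
      4 * ((freeKer t 0 : ℝ) : ℂ) +
      ∑ v ∈ nbr2 0, ∑ z ∈ nbr 0, ((dsharp z * dsymb (v - z)).trace / 8) *
        (((∑ z' ∈ nbr2 0, hhat z' * ((wedge v z' : ℤ) : ℝ) ^ 2 * (freeKer t (v + z') - freeKer t 0)) : ℝ) : ℂ) := by
  rw [← constant_A1a hsq, Finset.sum_mul, ← Finset.sum_add_distrib]
  refine Finset.sum_congr rfl fun v _ => ?_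
  rw [Finset.sum_mul, ← Finset.sum_add_distrib]
  refine Finset.sum_congr rfl fun z _ => ?_
  rw [mul_assoc, ← mul_add]
  congr 1
  push_cast
  rw [Finset.sum_mul, ← Finset.sum_add_distrib]
  refine Finset.sum_congr rfl fun z' _ => ?_
  ring

/-- `A₁ᵦ = R₁ᵦ` (its `k_t(0)`-part vanishes). -/
theorem A1b_eq (t : ℝ) :
    ∑ v ∈ nbr2 0, ∑ v' ∈ nbr2 0, (-(Complex.I / 2 * ((hhat v : ℝ) : ℂ) *
        (∑ z ∈ nbr 0, (Complex.I / 2 * ((wedge z v' : ℤ) : ℂ)) • (dsharp z * dsymb (v' - z))).trace)) *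
      (((((wedge v (v + v') : ℤ) : ℝ) * freeKer t (v + v')) : ℝ) : ℂ) =
    ∑ v ∈ nbr2 0, ∑ v' ∈ nbr2 0, (-(Complex.I / 2 * ((hhat v : ℝ) : ℂ) *
        (∑ z ∈ nbr 0, (Complex.I / 2 * ((wedge z v' : ℤ) : ℂ)) • (dsharp z * dsymb (v' - z))).trace)) *
      (((((wedge v (v + v') : ℤ) : ℝ) * (freeKer t (v + v') - freeKer t 0)) : ℝ) : ℂ) := by
  rw [← add_zero (∑ v ∈ nbr2 0, ∑ v' ∈ nbr2 0, (-(Complex.I / 2 * ((hhat v : ℝ) : ℂ) *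
        (∑ z ∈ nbr 0, (Complex.I / 2 * ((wedge z v' : ℤ) : ℂ)) • (dsharp z * dsymb (v' - z))).trace)) *
      (((((wedge v (v + v') : ℤ) : ℝ) * (freeKer t (v + v') - freeKer t 0)) : ℝ) : ℂ)),
    ← mul_zero (((freeKer t 0 : ℝ) : ℂ)), ← constant_A1b hsq, Finset.mul_sum, ← Finset.sum_add_distrib]
  refine Finset.sum_congr rfl fun v _ => ?_
  rw [Finset.mul_sum, ← Finset.sum_add_distrib]
  refine Finset.sum_congr rfl fun v' _ => ?_
  push_cast
  ring

omit hsq in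
/-- `A₂ = −4 k_t(0) + R₂`. -/
theorem A2_eq (t : ℝ) :
    ∑ v ∈ nbr2 0, ∑ v' ∈ nbr2 0,
        (-((∑ z ∈ nbr 0, (Complex.I / 2 * ((wedge z v : ℤ) : ℂ)) • (dsharp z * dsymb (v - z))) *
            (∑ z ∈ nbr 0, (Complex.I / 2 * ((wedge z v' : ℤ) : ℂ)) • (dsharp z * dsymb (v' - z)))).trace) *
          ((freeKer t (v + v') : ℝ) : ℂ) =
      -4 * ((freeKer t 0 : ℝ) : ℂ) +
      ∑ v ∈ nbr2 0, ∑ v' ∈ nbr2 0,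
        (-((∑ z ∈ nbr 0, (Complex.I / 2 * ((wedge z v : ℤ) : ℂ)) • (dsharp z * dsymb (v - z))) *
            (∑ z ∈ nbr 0, (Complex.I / 2 * ((wedge z v' : ℤ) : ℂ)) • (dsharp z * dsymb (v' - z)))).trace) *
          (((freeKer t (v + v') - freeKer t 0 : ℝ)) : ℂ) := by
  rw [← constant_A2, Finset.sum_mul, ← Finset.sum_add_distrib]
  refine Finset.sum_congr rfl fun v _ => ?_
  rw [Finset.sum_mul, ← Finset.sum_add_distrib]
  refine Finset.sum_congr rfl fun v' _ => ?_
  push_cast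
  ring

end Constants

/-- `‖Σ_{i,j} c_{ij} x_{ij}‖ ≤ Σ_{i,j} ‖c_{ij}‖ B_{ij}` when `|x_{ij}| ≤ B_{ij}`. -/
theorem norm_sum_sum_mul_ofReal_le {s : Finset (Site 4)} {t : Finset (Site 4)} (c : Site 4 → Site 4 → ℂ)
    (x B : Site 4 → Site 4 → ℝ) (h : ∀ i ∈ s, ∀ j ∈ t, |x i j| ≤ B i j) :
    ‖∑ i ∈ s, ∑ j ∈ t, c i j * ((x i j : ℝ) : ℂ)‖ ≤ ∑ i ∈ s, ∑ j ∈ t, ‖c i j‖ * B i j := by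
  refine (norm_sum_le _ _).trans (Finset.sum_le_sum fun i hi => ?_)
  refine (norm_sum_le _ _).trans (Finset.sum_le_sum fun j hj => ?_)
  rw [norm_mul, Complex.norm_real, Real.norm_eq_abs]
  exact mul_le_mul_of_nonneg_left (h i hi j hj) (norm_nonneg _)

/-- A weighted kernel-difference sum: `|Σ_{z'} a(z') (k_t(v+z') − k_t(0))| ≤ (C/t³) Σ_{z'} |a(z')| |v+z'|²`. -/
theorem abs_sum_mul_sub_le {C t : ℝ} (hD : ∀ u : Site 4, |freeKer t u - freeKer t 0| ≤ C * elen u ^ 2 / t ^ 3)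
    (a : Site 4 → ℝ) (v : Site 4) :
    |∑ z' ∈ nbr2 0, a z' * (freeKer t (v + z') - freeKer t 0)| ≤
      C / t ^ 3 * ∑ z' ∈ nbr2 0, |a z'| * elen (v + z') ^ 2 := by
  rw [Finset.mul_sum]
  refine (Finset.abs_sum_le_sum_abs _ _).trans (Finset.sum_le_sum fun z' _ => ?_)
  rw [abs_mul]
  calc |a z'| * |freeKer t (v + z') - freeKer t 0| ≤ |a z'| * (C * elen (v + z') ^ 2 / t ^ 3) :=
        mul_le_mul_of_nonneg_left (hD _) (abs_nonneg _)
    _ = C / t ^ 3 * (|a z'| * elen (v + z') ^ 2) := by ring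

/-- Bound of `A₀`: `‖A₀‖ ≤ K₀ · (C/t²)` when `|k_t(u)| ≤ C/t²`. -/
theorem norm_A0_le {t C : ℝ} (hk : ∀ u : Site 4, |freeKer t u| ≤ C / t ^ 2) :
    ‖∑ v ∈ nbr2 0, ∑ z ∈ nbr 0, (-(dsharp z * dsymb (v - z)).trace / 8) *
        (((((wedge z v : ℤ) : ℝ) ^ 2 * freeKer t v) : ℝ) : ℂ)‖ ≤
      (∑ v ∈ nbr2 0, ∑ z ∈ nbr 0, ‖-(dsharp z * dsymb (v - z)).trace / 8‖ * ((wedge z v : ℤ) : ℝ) ^ 2) *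
        (C / t ^ 2) := by
  refine (norm_sum_sum_mul_ofReal_le (s := nbr2 0) (t := nbr 0) (fun v z => -(dsharp z * dsymb (v - z)).trace / 8)
    (fun v z => ((wedge z v : ℤ) : ℝ) ^ 2 * freeKer t v) (fun v z => ((wedge z v : ℤ) : ℝ) ^ 2 * (C / t ^ 2))
    fun v _ z _ => ?_).trans (le_of_eq ?_)
  · rw [abs_mul, abs_of_nonneg (sq_nonneg _)]
    exact mul_le_mul_of_nonneg_left (hk v) (sq_nonneg _)
  · rw [Finset.sum_mul]
    refine Finset.sum_congr rfl fun v _ => ?_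
    rw [Finset.sum_mul]
    refine Finset.sum_congr rfl fun z _ => ?_
    ring

/-- Bound of the remainder `R₁ₐ`. -/
theorem norm_R1a_le {t C : ℝ} (hD : ∀ u : Site 4, |freeKer t u - freeKer t 0| ≤ C * elen u ^ 2 / t ^ 3) :
    ‖∑ v ∈ nbr2 0, ∑ z ∈ nbr 0, ((dsharp z * dsymb (v - z)).trace / 8) *
        (((∑ z' ∈ nbr2 0, hhat z' * ((wedge v z' : ℤ) : ℝ) ^ 2 * (freeKer t (v + z') - freeKer t 0)) : ℝ) : ℂ)‖ ≤
      (∑ v ∈ nbr2 0, ∑ z ∈ nbr 0, ‖(dsharp z * dsymb (v - z)).trace / 8‖ *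
        ∑ z' ∈ nbr2 0, |hhat z' * ((wedge v z' : ℤ) : ℝ) ^ 2| * elen (v + z') ^ 2) * (C / t ^ 3) := by
  refine (norm_sum_sum_mul_ofReal_le (s := nbr2 0) (t := nbr 0) (fun v z => (dsharp z * dsymb (v - z)).trace / 8)
    (fun v _ => ∑ z' ∈ nbr2 0, hhat z' * ((wedge v z' : ℤ) : ℝ) ^ 2 * (freeKer t (v + z') - freeKer t 0))
    (fun v _ => C / t ^ 3 * ∑ z' ∈ nbr2 0, |hhat z' * ((wedge v z' : ℤ) : ℝ) ^ 2| * elen (v + z') ^ 2)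
    fun v _ z _ => abs_sum_mul_sub_le hD _ v).trans (le_of_eq ?_)
  rw [Finset.sum_mul]
  refine Finset.sum_congr rfl fun v _ => ?_
  rw [Finset.sum_mul]
  refine Finset.sum_congr rfl fun z _ => ?_
  ring

/-- Bound of the remainder `R₁ᵦ`. -/
theorem norm_R1b_le {t C : ℝ} (hD : ∀ u : Site 4, |freeKer t u - freeKer t 0| ≤ C * elen u ^ 2 / t ^ 3) :
    ‖∑ v ∈ nbr2 0, ∑ v' ∈ nbr2 0, (-(Complex.I / 2 * ((hhat v : ℝ) : ℂ) *
        (∑ z ∈ nbr 0, (Complex.I / 2 * ((wedge z v' : ℤ) : ℂ)) • (dsharp z * dsymb (v' - z))).trace)) *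
      (((((wedge v (v + v') : ℤ) : ℝ) * (freeKer t (v + v') - freeKer t 0)) : ℝ) : ℂ)‖ ≤
      (∑ v ∈ nbr2 0, ∑ v' ∈ nbr2 0, ‖-(Complex.I / 2 * ((hhat v : ℝ) : ℂ) *
        (∑ z ∈ nbr 0, (Complex.I / 2 * ((wedge z v' : ℤ) : ℂ)) • (dsharp z * dsymb (v' - z))).trace)‖ *
          (|((wedge v (v + v') : ℤ) : ℝ)| * elen (v + v') ^ 2)) * (C / t ^ 3) := by
  refine (norm_sum_sum_mul_ofReal_le (s := nbr2 0) (t := nbr2 0) _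
    (fun v v' => ((wedge v (v + v') : ℤ) : ℝ) * (freeKer t (v + v') - freeKer t 0))
    (fun v v' => |((wedge v (v + v') : ℤ) : ℝ)| * elen (v + v') ^ 2 * (C / t ^ 3))
    fun v _ v' _ => ?_).trans (le_of_eq ?_)
  · rw [abs_mul]
    calc |((wedge v (v + v') : ℤ) : ℝ)| * |freeKer t (v + v') - freeKer t 0|
        ≤ |((wedge v (v + v') : ℤ) : ℝ)| * (C * elen (v + v') ^ 2 / t ^ 3) :=
          mul_le_mul_of_nonneg_left (hD _) (abs_nonneg _)
      _ = _ := by ring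
  · rw [Finset.sum_mul]
    refine Finset.sum_congr rfl fun v _ => ?_
    rw [Finset.sum_mul]
    refine Finset.sum_congr rfl fun v' _ => ?_
    ring

/-- Bound of the remainder `R₂`. -/
theorem norm_R2_le {t C : ℝ} (hD : ∀ u : Site 4, |freeKer t u - freeKer t 0| ≤ C * elen u ^ 2 / t ^ 3) :
    ‖∑ v ∈ nbr2 0, ∑ v' ∈ nbr2 0,
        (-((∑ z ∈ nbr 0, (Complex.I / 2 * ((wedge z v : ℤ) : ℂ)) • (dsharp z * dsymb (v - z))) *
            (∑ z ∈ nbr 0, (Complex.I / 2 * ((wedge z v' : ℤ) : ℂ)) • (dsharp z * dsymb (v' - z)))).trace) *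
          (((freeKer t (v + v') - freeKer t 0 : ℝ)) : ℂ)‖ ≤
      (∑ v ∈ nbr2 0, ∑ v' ∈ nbr2 0,
        ‖-((∑ z ∈ nbr 0, (Complex.I / 2 * ((wedge z v : ℤ) : ℂ)) • (dsharp z * dsymb (v - z))) *
            (∑ z ∈ nbr 0, (Complex.I / 2 * ((wedge z v' : ℤ) : ℂ)) • (dsharp z * dsymb (v' - z)))).trace‖ *
          elen (v + v') ^ 2) * (C / t ^ 3) := by
  refine (norm_sum_sum_mul_ofReal_le (s := nbr2 0) (t := nbr2 0) _
    (fun v v' => freeKer t (v + v') - freeKer t 0) (fun v v' => elen (v + v') ^ 2 * (C / t ^ 3))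
    fun v _ v' _ => (hD _).trans (le_of_eq (by ring))).trans (le_of_eq ?_)
  rw [Finset.sum_mul]
  refine Finset.sum_congr rfl fun v _ => ?_
  rw [Finset.sum_mul]
  refine Finset.sum_congr rfl fun v' _ => ?_
  ring

/-- The final bookkeeping, with the finite sums abstracted: from the bounds of `A₀`, `R₁ₐ`, `R₁ᵦ`, `R₂` and
the on-diagonal asymptotics of `k_t(0)` to `‖e2 t − 1/(12π²)‖ ≤ C/t` (the `k_t(0)`-coefficients combine to
`(−4/6 + 4/2) t² k_t(0) = (4/3) t² k_t(0) → (4/3)/(16π²) = 1/(12π²)`). -/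
theorem final_bound {t : ℝ} (ht : 1 ≤ t) {A0 R1a R1b R2 : ℂ} {k0 K0 K1a K1b K2 Cg C₂ C₃ : ℝ}
    (hA0 : ‖A0‖ ≤ K0 * (Cg / t ^ 2)) (hR1a : ‖R1a‖ ≤ K1a * (C₂ / t ^ 3)) (hR1b : ‖R1b‖ ≤ K1b * (C₂ / t ^ 3))
    (hR2 : ‖R2‖ ≤ K2 * (C₂ / t ^ 3)) (hk0 : |k0 - 1 / (16 * Real.pi ^ 2 * t ^ 2)| ≤ C₃ / t ^ 3) :
    ‖-((t : ℂ) * A0 + ((t ^ 2 / 6 : ℝ) : ℂ) * (4 * ((k0 : ℝ) : ℂ) + R1a + R1b) +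
        ((t ^ 2 / 2 : ℝ) : ℂ) * (-4 * ((k0 : ℝ) : ℂ) + R2)) - ((1 / (12 * Real.pi ^ 2) : ℝ) : ℂ)‖ ≤
      (Cg * K0 + C₂ / 6 * (K1a + K1b) + C₂ / 2 * K2 + 4 / 3 * C₃) / t := by
  have ht0 : 0 < t := by linarith
  have halg : -((t : ℂ) * A0 + ((t ^ 2 / 6 : ℝ) : ℂ) * (4 * ((k0 : ℝ) : ℂ) + R1a + R1b) +
      ((t ^ 2 / 2 : ℝ) : ℂ) * (-4 * ((k0 : ℝ) : ℂ) + R2)) - ((1 / (12 * Real.pi ^ 2) : ℝ) : ℂ) =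
      -((t : ℂ) * A0) - ((t ^ 2 / 6 : ℝ) : ℂ) * (R1a + R1b) - ((t ^ 2 / 2 : ℝ) : ℂ) * R2 +
        ((4 / 3 * t ^ 2 : ℝ) : ℂ) * (((k0 - 1 / (16 * Real.pi ^ 2 * t ^ 2) : ℝ)) : ℂ) := by
    have hπ : (Real.pi : ℂ) ≠ 0 := Complex.ofReal_ne_zero.mpr Real.pi_ne_zero
    have ht' : (t : ℂ) ≠ 0 := Complex.ofReal_ne_zero.mpr ht0.ne'
    push_cast
    field_simp
    ring
  rw [halg]
  have n1 : ‖-((t : ℂ) * A0)‖ ≤ t * (K0 * (Cg / t ^ 2)) := by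
    rw [norm_neg, norm_mul, Complex.norm_real, Real.norm_eq_abs, abs_of_pos ht0]
    exact mul_le_mul_of_nonneg_left hA0 ht0.le
  have n2 : ‖((t ^ 2 / 6 : ℝ) : ℂ) * (R1a + R1b)‖ ≤ t ^ 2 / 6 * (K1a * (C₂ / t ^ 3) + K1b * (C₂ / t ^ 3)) := by
    rw [norm_mul, Complex.norm_real, Real.norm_eq_abs, abs_of_pos (by positivity)]
    exact mul_le_mul_of_nonneg_left ((norm_add_le _ _).trans (add_le_add hR1a hR1b)) (by positivity)
  have n3 : ‖((t ^ 2 / 2 : ℝ) : ℂ) * R2‖ ≤ t ^ 2 / 2 * (K2 * (C₂ / t ^ 3)) := by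
    rw [norm_mul, Complex.norm_real, Real.norm_eq_abs, abs_of_pos (by positivity)]
    exact mul_le_mul_of_nonneg_left hR2 (by positivity)
  have n4 : ‖((4 / 3 * t ^ 2 : ℝ) : ℂ) * (((k0 - 1 / (16 * Real.pi ^ 2 * t ^ 2) : ℝ)) : ℂ)‖ ≤
      4 / 3 * t ^ 2 * (C₃ / t ^ 3) := by
    rw [norm_mul, Complex.norm_real, Complex.norm_real, Real.norm_eq_abs, Real.norm_eq_abs,
      abs_of_pos (by positivity)]
    exact mul_le_mul_of_nonneg_left hk0 (by positivity)
  calc ‖-((t : ℂ) * A0) - ((t ^ 2 / 6 : ℝ) : ℂ) * (R1a + R1b) - ((t ^ 2 / 2 : ℝ) : ℂ) * R2 +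
        ((4 / 3 * t ^ 2 : ℝ) : ℂ) * (((k0 - 1 / (16 * Real.pi ^ 2 * t ^ 2) : ℝ)) : ℂ)‖
      ≤ ‖-((t : ℂ) * A0)‖ + ‖((t ^ 2 / 6 : ℝ) : ℂ) * (R1a + R1b)‖ + ‖((t ^ 2 / 2 : ℝ) : ℂ) * R2‖ +
          ‖((4 / 3 * t ^ 2 : ℝ) : ℂ) * (((k0 - 1 / (16 * Real.pi ^ 2 * t ^ 2) : ℝ)) : ℂ)‖ := by
        refine (norm_add_le _ _).trans (add_le_add ?_ le_rfl)
        refine (norm_sub_le _ _).trans (add_le_add ?_ le_rfl)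
        exact norm_sub_le _ _
    _ ≤ t * (K0 * (Cg / t ^ 2)) + t ^ 2 / 6 * (K1a * (C₂ / t ^ 3) + K1b * (C₂ / t ^ 3)) +
          t ^ 2 / 2 * (K2 * (C₂ / t ^ 3)) + 4 / 3 * t ^ 2 * (C₃ / t ^ 3) :=
        add_le_add (add_le_add (add_le_add n1 n2) n3) n4
    _ = (Cg * K0 + C₂ / 6 * (K1a + K1b) + C₂ / 2 * K2 + 4 / 3 * C₃) / t := by
        field_simp

/-- **Second-order coefficient** (the content of stub `stub_secondOrderCoefficient`): given the Gaussian bound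
of the free kernel (conjunct (1) of `FreeMajorantToolkit`) and conjuncts (1), (3), (5), (6), (7) of
`FreeHeatCalculus`, `‖e2 t − 1/(12π²)‖ ≤ C/t` for `t ≥ 1`. -/
theorem secondOrderCoefficient_of
    (hgauss : ∃ C c : ℝ, 0 < c ∧ ∀ t : ℝ, 0 ≤ t → ∀ w : Site 4, |freeKer t w| ≤ C * gaussProfile c t w)
    (hsq : ∀ x y : Site 4, sqKer (fun _ => (1 : ℂ)) x y = ((hhat (y - x) : ℝ) : ℂ) • (1 : Spin))
    (hδ : ∀ w : Site 4, freeKer 0 w = if w = 0 then 1 else 0)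
    (hsemi : ∀ s r : ℝ, 0 ≤ s → 0 ≤ r → ∀ w : Site 4,
      HasSum (fun y : Site 4 => freeKer s y * freeKer r (w - y)) (freeKer (s + r) w))
    (hibp : ∀ t : ℝ, 0 ≤ t → ∀ (w : Site 4) (ν : Fin 4),
      t * (∑ z ∈ nbr2 0, ((z ν : ℤ) : ℝ) * hhat z * freeKer t (w - z)) + ((w ν : ℤ) : ℝ) * freeKer t w = 0)
    (heven : ∀ (t : ℝ) (w : Site 4), freeKer t (-w) = freeKer t w) :
    ∃ C : ℝ, ∀ t : ℝ, 1 ≤ t → ‖e2 t - ((1 / (12 * Real.pi ^ 2) : ℝ) : ℂ)‖ ≤ C / t := by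
  obtain ⟨Cg, c, hc, hg⟩ := hgauss
  have hk : ∀ t : ℝ, 1 ≤ t → ∀ u : Site 4, |freeKer t u| ≤ |Cg| / t ^ 2 := by
    intro t ht u
    have ht0 : 0 < t := by linarith
    have he : 0 ≤ elen u := Real.sqrt_nonneg _
    have hΓ0 : 0 ≤ gaussProfile c t u := by unfold gaussProfile; positivity
    have hΓ : gaussProfile c t u ≤ 1 / t ^ 2 := by
      unfold gaussProfile
      calc ((1 + t) ^ 2)⁻¹ * Real.exp (-(c * elen u ^ 2 / (1 + t + elen u)))
          ≤ ((1 + t) ^ 2)⁻¹ * 1 := by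
            refine mul_le_mul_of_nonneg_left ?_ (by positivity)
            rw [Real.exp_le_one_iff, neg_nonpos]
            positivity
        _ ≤ 1 / t ^ 2 := by
            rw [mul_one, ← one_div]
            exact one_div_le_one_div_of_le (by positivity) (by nlinarith)
    calc |freeKer t u| ≤ Cg * gaussProfile c t u := hg t ht0.le u
      _ ≤ |Cg| * gaussProfile c t u := mul_le_mul_of_nonneg_right (le_abs_self _) hΓ0
      _ ≤ |Cg| * (1 / t ^ 2) := mul_le_mul_of_nonneg_left hΓ (abs_nonneg _)
      _ = |Cg| / t ^ 2 := by ring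
  obtain ⟨C₂, hC₂⟩ := exists_abs_freeKer_sub_freeKer_zero_le
  obtain ⟨C₃, hC₃⟩ := exists_abs_freeKer_zero_sub_le
  exact ⟨_, fun t ht => by
    have ht0 : 0 < t := by linarith
    rw [e2_eq_collapsed hsq hδ hsemi hibp heven ht0, A1a_eq hsq t, A1b_eq hsq t, A2_eq t]
    exact final_bound ht (norm_A0_le (hk t ht)) (norm_R1a_le (hC₂ t ht)) (norm_R1b_le (hC₂ t ht))
      (norm_R2_le (hC₂ t ht)) (hC₃ t ht)⟩

end Summit.QuantumFields.QCD.Cruxes.QuarkLoopCoefficient.Sketch.SecondOrderCoefficient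

namespace Summit.QuantumFields.QCD.Cruxes.QuarkLoopCoefficient.Sketch

open Literature.Probability.LatticeModels (Site TorusSite)
open Summit.QuantumFields.QCD.Theorems.QuarkLoopCoefficient

/-- **Stub `stub_secondOrderCoefficient`** of the line `Sketch` of crux stmt-QuantumFields-16786
(`FreeMajorantToolkit → FreeHeatCalculus → SecondOrderCoefficient`, expanded; registered text). -/
theorem stub_secondOrderCoefficient :
    ((∃ C c : ℝ, 0 < c ∧ ∀ t : ℝ, 0 ≤ t → ∀ w : Site 4, |freeKer t w| ≤ C * gaussProfile c t w) ∧
      (∀ c ε : ℝ, 0 < c → 0 < ε → ε < 1 → ∃ B : ℝ, ∀ a b : ℝ, 0 ≤ a → 0 ≤ b → ∀ w : Site 4,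
        Summable (fun y : Site 4 => gaussProfile ((1 - ε) * c) a y * gaussProfile c b (w - y)) ∧
        ∑' y : Site 4, gaussProfile ((1 - ε) * c) a y * gaussProfile c b (w - y) ≤
          B * gaussProfile ((1 - ε) * c) (a + b) w) ∧
      (∀ c ε : ℝ, 0 < c → 0 < ε → ε < 1 → ∀ j : ℕ, ∃ A : ℝ, ∀ t : ℝ, 0 ≤ t → ∀ w : Site 4,
        elen w ^ j * gaussProfile c t w ≤ A * Real.sqrt (1 + t) ^ j * gaussProfile ((1 - ε) * c) t w) ∧
      (∀ c ε : ℝ, 0 < c → 0 < ε → ε < 1 → ∃ A : ℝ, ∀ t : ℝ, 0 ≤ t → ∀ w z : Site 4, elen z ≤ 2 →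
        gaussProfile c t (w + z) ≤ A * gaussProfile ((1 - ε) * c) t w) ∧
      (∀ c : ℝ, 0 < c → ∃ A : ℝ, ∀ t : ℝ, 0 ≤ t →
        Summable (fun y : Site 4 => gaussProfile c t y) ∧ ∑' y : Site 4, gaussProfile c t y ≤ A) ∧
      (∀ c : ℝ, 0 < c → ∃ C : ℝ, ∀ (L : ℕ), 1 ≤ L → ∀ t : ℝ, 1 ≤ t → t ≤ (L : ℝ) ^ 2 →
        Summable (fun n : Site 4 => gaussProfile c t (fun μ => (L : ℤ) * n μ)) ∧
        ∑' n : Site 4, (if n = 0 then 0 else gaussProfile c t (fun μ => (L : ℤ) * n μ)) ≤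
          C * Real.exp (-(c / 2 * (L : ℝ) ^ 2 / (t + (L : ℝ)))) / t ^ 2)) →
    ((∀ x y : Site 4, sqKer (fun _ => (1 : ℂ)) x y = ((hhat (y - x) : ℝ) : ℂ) • (1 : Spin)) ∧
      (∀ t : ℝ, 0 ≤ t → ∀ x y : Site 4,
        heatKer (fun _ => (1 : ℂ)) t x y = ((freeKer t (y - x) : ℝ) : ℂ) • (1 : Spin)) ∧
      (∀ w : Site 4, freeKer 0 w = if w = 0 then 1 else 0) ∧
      (∀ (t : ℝ) (w : Site 4),
        HasDerivAt (fun s => freeKer s w) (-(∑ z ∈ nbr2 0, hhat z * freeKer t (w - z))) t) ∧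
      (∀ s r : ℝ, 0 ≤ s → 0 ≤ r → ∀ w : Site 4,
        HasSum (fun y : Site 4 => freeKer s y * freeKer r (w - y)) (freeKer (s + r) w)) ∧
      (∀ t : ℝ, 0 ≤ t → ∀ (w : Site 4) (ν : Fin 4),
        t * (∑ z ∈ nbr2 0, ((z ν : ℤ) : ℝ) * hhat z * freeKer t (w - z)) + ((w ν : ℤ) : ℝ) * freeKer t w = 0) ∧
      (∀ (t : ℝ) (w : Site 4), freeKer t (-w) = freeKer t w)) →
    (∃ C : ℝ, ∀ t : ℝ, 1 ≤ t → ‖e2 t - ((1 / (12 * Real.pi ^ 2) : ℝ) : ℂ)‖ ≤ C / t) :=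
  fun h1 h2 => SecondOrderCoefficient.secondOrderCoefficient_of h1.1 h2.1 h2.2.2.1 h2.2.2.2.2.1
    h2.2.2.2.2.2.1 h2.2.2.2.2.2.2

end Summit.QuantumFields.QCD.Cruxes.QuarkLoopCoefficient.Sketch

end
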